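import Literature.Geometry.Riemannian.GurskyViaclovskyClosednessEKOperatorAux
import Literature.Analysis.PDE.EvansKrylovDifferentiated
import HarnessLib

/-!
# Gursky–Viaclovsky closedness: the Evans–Krylov form of the chart equation — top-slot
# derivatives and the two concavity inequalities (Gilbarg–Trudinger's hypothesis (ii)')

Support file (everything PROVED; no definition, no named fact) for the named fact
`Literature.Geometry.Riemannian.gurskyViaclovsky_pathClosed_weighted_four`
(Gursky–Viaclovsky, J. Differential Geom. 63 (2003), Prop. 6: the interior `C^{2,α}` estimate of
the closedness step is Evans–Krylov's, Gilbarg–Trudinger Thm. 17.14, whose hypothesis (ii)' is the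
concavity of the operator in the second derivatives — for the chart equation, that of `σ₂^{1/2}`
on the cone `Γ₂⁺`, Gursky–Viaclovsky Prop. 1 (iii)). For the jet function
`ekOperator G W Q ψ (y, t, J) = ψ(Σ^t(y, pOf J, rOf J)) − ψ(¼(Q e^{4J₀} + ¼W))`
(`GurskyViaclovskyClosednessEKOperatorDef.lean`; smoothness, vanishing along solutions and the
frame formula along top-slot lines in `GurskyViaclovskyClosednessEKOperatorAux.lean`):

* `fderiv_ekOperator_topJet`, `fderiv_ekOperator_topJet_line` — the top-slot derivative
  `D(ekOperator)(y,t,J)[(0,0,topJet Ω)] = σ₂(M,B)/σ₂(M)^{1/2}` at a jet with `Σ^t > c/2`, `M` the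
  frame array of `𝒜^t`, `B` that of the direction (Gilbarg–Trudinger's `F_{ij}` for
  `F = σ₂^{1/2}`), and its value along the line `J + s·topJet Ω`;
* `fderiv_fderiv_ekOperator_topJet_nonpos` — **(ii)' infinitesimally**:
  `D²(ekOperator)(y,t,J)[(0,0,topJet Ω)]² ≤ 0` at an admissible jet
  (`sqrt_sigma2_line_second_deriv_nonpos`, `EvansKrylov.hasDerivAt_deriv_comp_curve`);
* `ekOperator_hybrid_sub_le` — **(ii)' between a jet and a hybrid jet**:
  `ekOperator(J + topJet(J'₂ − J₂)) − ekOperator(J) ≤ D(ekOperator)(J)[(0,0,topJet(J'₂ − J₂))]`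
  (`sqrt_sigma2_le_tangent`);
* `fderiv_fderiv_ekOperator_nonpos_of_solution`, `ekOperator_hybrid_sub_le_of_solution` — the
  same at the jets `cjet₂F(y)` (and the hybrid jets `(DF(y), D²F(x))`) of an admissible solution
  of the background equation with `q ≥ q₀ > 0`, `|f| ≤ C`, `t ≤ 1` and a cutoff `ψ = √` on
  `[c/2, ∞)`, `0 < c ≤ q₀e^{−4C}/4` (`solution_frame_admissible` of the Aux file).

## References

* D. Gilbarg, N. S. Trudinger, *Elliptic Partial Differential Equations of Second Order* (2001),
  §17.4, (17.43), (17.45) and the proof of Thm. 17.14 (use of (ii)'). [GilbargTrudinger2001]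
* M. J. Gursky, J. A. Viaclovsky, J. Differential Geom. 63 (2003) 131–154, §2 Def. 2,
  Prop. 1 (iii), Prop. 6. [GurskyViaclovsky2003]
-/

noncomputable section

set_option maxSynthPendingDepth 3

open scoped Manifold ContDiff Topology
open Set Filter Metric Function Module

namespace Literature.Geometry.Riemannian.GurskyViaclovskyPath

open Literature.Geometry.Lorentzian (PseudoRiemannianMetric)
open Literature.Geometry.Lorentzian.PseudoRiemannianMetric
open Literature.Geometry.Lorentzian
open Literature.Geometry.Lorentzian.MetricCoord
open Literature.Geometry.Riemannian.GurskyViaclovsky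
open Literature.Analysis.Calculus Literature.Analysis.PDE.EvansKrylov

section OpensChart

variable {U : TopologicalSpace.Opens (EuclideanSpace ℝ (Fin 4))}
  (g : PseudoRiemannianMetric 𝓘(ℝ, EuclideanSpace ℝ (Fin 4)) ∞ (EuclideanSpace ℝ (Fin 4))
    (TangentSpace 𝓘(ℝ, EuclideanSpace ℝ (Fin 4)) : U → Type _))
  [g.HasLeviCivita]
  {G : EuclideanSpace ℝ (Fin 4) →
    EuclideanSpace ℝ (Fin 4) →L[ℝ] EuclideanSpace ℝ (Fin 4) →L[ℝ] ℝ}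
  (hG : ∀ y : U, g.val y = G y)

/-! ### The top-slot derivative -/

include hG in
/-- **The top-slot derivative of the Evans–Krylov jet function** at a jet point where
`Σ^t > c/2` (so that `ψ = √` nearby): `D(ekOperator)(y,t,J)[(0,0,topJet Ω)] = σ₂(M, B)/σ₂(M)^{1/2}`
with the frame arrays `M`, `B` of `chartOperator_zero_topJet_line` (`hasDerivAt_sqrt_sigma2_line`
at `s = 0`; the second `ψ`-term does not depend on the top slot).
[cite: GilbargTrudinger2001, §17.4, (17.43); GurskyViaclovsky2003, §2 Def. 2] -/
theorem fderiv_ekOperator_topJet (t : ℝ) (y : U)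
    {b : Basis (Fin 4) ℝ (TangentSpace 𝓘(ℝ, EuclideanSpace ℝ (Fin 4)) y)}
    (hb : g.IsOrthonormalFrame y b) {W Q : EuclideanSpace ℝ (Fin 4) → ℝ}
    (hW : ContDiffOn ℝ ∞ W (U : Set (EuclideanSpace ℝ (Fin 4))))
    (hQ : ContDiffOn ℝ ∞ Q (U : Set (EuclideanSpace ℝ (Fin 4)))) {ψ : ℝ → ℝ} {c : ℝ}
    (hψ : ContDiff ℝ ∞ ψ) (hψc : ∀ s, c / 2 ≤ s → ψ s = Real.sqrt s) {J : CJet (Fin 4) 2}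
    (hJ : ∀ v w, rOf (EuclideanSpace.basisFun (Fin 4) ℝ) J v w =
      rOf (EuclideanSpace.basisFun (Fin 4) ℝ) J w v)
    (hcM : c / 2 < sigma2 (fun a c ↦ gvForm G t y (pOf (EuclideanSpace.basisFun (Fin 4) ℝ) J)
      (rOf (EuclideanSpace.basisFun (Fin 4) ℝ) J) (b a) (b c)))
    {Ω : (Fin 2 → Fin 4) → ℝ} (hΩ : ∀ i j, Ω ![i, j] = Ω ![j, i]) :
    fderiv ℝ (ekOperator G W Q ψ) ((y : EuclideanSpace ℝ (Fin 4)), t, J)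
        ((0 : EuclideanSpace ℝ (Fin 4)), (0 : ℝ), topJet Ω) =
      sigma2Polar
          (fun a c ↦ gvForm G t y (pOf (EuclideanSpace.basisFun (Fin 4) ℝ) J)
            (rOf (EuclideanSpace.basisFun (Fin 4) ℝ) J) (b a) (b c))
          (fun a c ↦ rOf (EuclideanSpace.basisFun (Fin 4) ℝ) (topJet Ω) (b a) (b c) +
            (1 - t) / 2 * mtrAt G y (rOf (EuclideanSpace.basisFun (Fin 4) ℝ) (topJet Ω)) *
              G y (b a) (b c)) /
        Real.sqrt (sigma2 (fun a c ↦ gvForm G t y (pOf (EuclideanSpace.basisFun (Fin 4) ℝ) J)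
          (rOf (EuclideanSpace.basisFun (Fin 4) ℝ) J) (b a) (b c))) := by
  have hc : 0 < c := pos_of_differentiable_sqrt_cutoff (hψ.differentiable (by simp)) hψc
  set x₀ : (EuclideanSpace ℝ (Fin 4)) × ℝ × CJet (Fin 4) 2 := ((y : (EuclideanSpace ℝ (Fin 4))), t, J) with hx₀
  set v : (EuclideanSpace ℝ (Fin 4)) × ℝ × CJet (Fin 4) 2 := ((0 : (EuclideanSpace ℝ (Fin 4))), (0 : ℝ), topJet Ω) with hv
  have hMs := fun a c ↦ gvForm_frame_symm g hG t y b (pOf (EuclideanSpace.basisFun (Fin 4) ℝ) J) hJ a c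
  have hBs := topJet_frame_symm g hG t y b hΩ
  have hopen : IsOpen {x : (EuclideanSpace ℝ (Fin 4)) × ℝ × CJet (Fin 4) 2 | x.1 ∈ (U : Set (EuclideanSpace ℝ (Fin 4)))} :=
    U.2.preimage continuous_fst
  have hdΦ : DifferentiableAt ℝ (ekOperator G W Q ψ) x₀ :=
    ((contDiffOn_ekOperator g hG hW hQ hψ).differentiableOn (by simp)).differentiableAt
      (hopen.mem_nhds y.2)
  -- the jet function along the line `x₀ + s v`
  have hline : ∀ s : ℝ, ekOperator G W Q ψ (x₀ + s • v) =
      ψ (sigma2 (fun a c ↦ gvForm G t y (pOf (EuclideanSpace.basisFun (Fin 4) ℝ) J) (rOf (EuclideanSpace.basisFun (Fin 4) ℝ) J) (b a) (b c) +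
        s * (rOf (EuclideanSpace.basisFun (Fin 4) ℝ) (topJet Ω) (b a) (b c) +
          (1 - t) / 2 * mtrAt G y (rOf (EuclideanSpace.basisFun (Fin 4) ℝ) (topJet Ω)) * G y (b a) (b c)))) -
        ψ ((Q y * Real.exp (4 * J 0 Fin.elim0) + W y / 4) / 4) := by
    intro s
    have h1 : x₀ + s • v = ((y : (EuclideanSpace ℝ (Fin 4))), t, J + s • topJet Ω) := by
      simp only [hx₀, hv, Prod.smul_mk, smul_zero, Prod.mk_add_mk, add_zero]
    rw [h1, ekOperator_apply, chartOperator_zero_topJet_line g hG t y hb hJ hΩ s,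
      add_smul_topJet_apply_zero]
  -- differentiate along the line in two ways
  have hℓ : HasDerivAt (fun s : ℝ ↦ x₀ + s • v) v 0 := by
    simpa using ((hasDerivAt_id (0 : ℝ)).smul_const v).const_add x₀
  have hd1 : HasDerivAt (fun s : ℝ ↦ ekOperator G W Q ψ (x₀ + s • v))
      (fderiv ℝ (ekOperator G W Q ψ) x₀ v) 0 :=
    hdΦ.hasFDerivAt.comp_hasDerivAt_of_eq (0 : ℝ) hℓ (by simp)
  have hd2 := hasDerivAt_cutoff_sigma2_line hMs hBs hc hψc hcM
    (ψ ((Q y * Real.exp (4 * J 0 Fin.elim0) + W y / 4) / 4))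
  rw [funext hline] at hd1
  exact hd1.unique hd2

include hG in
/-- **The top-slot derivative along a top-slot line**: with the data of `fderiv_ekOperator_topJet`,
at the jets `J + s·topJet Ω` with `σ₂(M + sB) > c/2`,
`D(ekOperator)(y,t,J + s·topJet Ω)[(0,0,topJet Ω)] = (σ₂(M,B) + sσ₂(B))/σ₂(M + sB)^{1/2}`
(the frame array there is `M + sB`, and `σ₂(M + sB, B) = σ₂(M,B) + sσ₂(B)`).
[cite: GilbargTrudinger2001, §17.4, (17.43)] -/
theorem fderiv_ekOperator_topJet_line (t : ℝ) (y : U)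
    {b : Basis (Fin 4) ℝ (TangentSpace 𝓘(ℝ, EuclideanSpace ℝ (Fin 4)) y)}
    (hb : g.IsOrthonormalFrame y b) {W Q : EuclideanSpace ℝ (Fin 4) → ℝ}
    (hW : ContDiffOn ℝ ∞ W (U : Set (EuclideanSpace ℝ (Fin 4))))
    (hQ : ContDiffOn ℝ ∞ Q (U : Set (EuclideanSpace ℝ (Fin 4)))) {ψ : ℝ → ℝ} {c : ℝ}
    (hψ : ContDiff ℝ ∞ ψ) (hψc : ∀ s, c / 2 ≤ s → ψ s = Real.sqrt s) {J : CJet (Fin 4) 2}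
    (hJ : ∀ v w, rOf (EuclideanSpace.basisFun (Fin 4) ℝ) J v w = rOf (EuclideanSpace.basisFun (Fin 4) ℝ) J w v) {Ω : (Fin 2 → Fin 4) → ℝ}
    (hΩ : ∀ i j, Ω ![i, j] = Ω ![j, i]) {s : ℝ}
    (hs : c / 2 < sigma2 (fun a c ↦ gvForm G t y (pOf (EuclideanSpace.basisFun (Fin 4) ℝ) J) (rOf (EuclideanSpace.basisFun (Fin 4) ℝ) J) (b a) (b c) +
      s * (rOf (EuclideanSpace.basisFun (Fin 4) ℝ) (topJet Ω) (b a) (b c) +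
        (1 - t) / 2 * mtrAt G y (rOf (EuclideanSpace.basisFun (Fin 4) ℝ) (topJet Ω)) * G y (b a) (b c)))) :
    fderiv ℝ (ekOperator G W Q ψ) ((y : EuclideanSpace ℝ (Fin 4)), t, J + s • topJet Ω)
        ((0 : EuclideanSpace ℝ (Fin 4)), (0 : ℝ), topJet Ω) =
      (sigma2Polar (fun a c ↦ gvForm G t y (pOf (EuclideanSpace.basisFun (Fin 4) ℝ) J) (rOf (EuclideanSpace.basisFun (Fin 4) ℝ) J) (b a) (b c))
            (fun a c ↦ rOf (EuclideanSpace.basisFun (Fin 4) ℝ) (topJet Ω) (b a) (b c) +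
              (1 - t) / 2 * mtrAt G y (rOf (EuclideanSpace.basisFun (Fin 4) ℝ) (topJet Ω)) * G y (b a) (b c)) +
          sigma2 (fun a c ↦ rOf (EuclideanSpace.basisFun (Fin 4) ℝ) (topJet Ω) (b a) (b c) +
              (1 - t) / 2 * mtrAt G y (rOf (EuclideanSpace.basisFun (Fin 4) ℝ) (topJet Ω)) * G y (b a) (b c)) * s) /
        Real.sqrt (sigma2 (fun a c ↦ gvForm G t y (pOf (EuclideanSpace.basisFun (Fin 4) ℝ) J) (rOf (EuclideanSpace.basisFun (Fin 4) ℝ) J) (b a) (b c) +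
          s * (rOf (EuclideanSpace.basisFun (Fin 4) ℝ) (topJet Ω) (b a) (b c) +
            (1 - t) / 2 * mtrAt G y (rOf (EuclideanSpace.basisFun (Fin 4) ℝ) (topJet Ω)) * G y (b a) (b c)))) := by
  have hBs := topJet_frame_symm g hG t y b hΩ
  have harr : (fun a c ↦ gvForm G t y (pOf (EuclideanSpace.basisFun (Fin 4) ℝ) (J + s • topJet Ω)) (rOf (EuclideanSpace.basisFun (Fin 4) ℝ) (J + s • topJet Ω))
      (b a) (b c)) = fun a c ↦ gvForm G t y (pOf (EuclideanSpace.basisFun (Fin 4) ℝ) J) (rOf (EuclideanSpace.basisFun (Fin 4) ℝ) J) (b a) (b c) +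
        s * (rOf (EuclideanSpace.basisFun (Fin 4) ℝ) (topJet Ω) (b a) (b c) +
          (1 - t) / 2 * mtrAt G y (rOf (EuclideanSpace.basisFun (Fin 4) ℝ) (topJet Ω)) * G y (b a) (b c)) := by
    funext a c
    exact gvForm_topJet_line t y J Ω s (b a) (b c)
  have hcMs : c / 2 < sigma2 (fun a c ↦ gvForm G t y (pOf (EuclideanSpace.basisFun (Fin 4) ℝ) (J + s • topJet Ω))
      (rOf (EuclideanSpace.basisFun (Fin 4) ℝ) (J + s • topJet Ω)) (b a) (b c)) := by
    rw [harr]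
    exact hs
  rw [fderiv_ekOperator_topJet g hG t y hb hW hQ hψ hψc (rOf_add_smul_topJet_symm (EuclideanSpace.basisFun (Fin 4) ℝ) hJ hΩ s)
    hcMs hΩ, harr, sigma2Polar_add_smul_left, sigma2Polar_self hBs]
  ring

/-! ### Concavity in the top slot: the second derivative -/

include hG in
/-- **Concavity in the top slot (Gilbarg–Trudinger's (ii)' infinitesimally, "`F_{ij,kl} ≤ 0`")**:
at a jet point whose frame array `M` is admissible (`M ∈ Γ₂⁺`) with `σ₂(M) > c/2`, for every
symmetric `Ω`, `D²(ekOperator)(y,t,J)[(0,0,topJet Ω)]² = (σ₂(M)σ₂(B) − σ₂(M,B)²)/σ₂(M)^{3/2} ≤ 0`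
(`sqrt_sigma2_line_second_deriv_nonpos`; the second derivative along the line is the second
Fréchet derivative on the diagonal, `EvansKrylov.hasDerivAt_deriv_comp_curve`).
[cite: GilbargTrudinger2001, §17.4, (17.45); GurskyViaclovsky2003, §2 Prop. 1 (iii)] -/
theorem fderiv_fderiv_ekOperator_topJet_nonpos (t : ℝ) (y : U)
    {b : Basis (Fin 4) ℝ (TangentSpace 𝓘(ℝ, EuclideanSpace ℝ (Fin 4)) y)}
    (hb : g.IsOrthonormalFrame y b) {W Q : EuclideanSpace ℝ (Fin 4) → ℝ}
    (hW : ContDiffOn ℝ ∞ W (U : Set (EuclideanSpace ℝ (Fin 4))))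
    (hQ : ContDiffOn ℝ ∞ Q (U : Set (EuclideanSpace ℝ (Fin 4)))) {ψ : ℝ → ℝ} {c : ℝ}
    (hψ : ContDiff ℝ ∞ ψ) (hψc : ∀ s, c / 2 ≤ s → ψ s = Real.sqrt s) {J : CJet (Fin 4) 2}
    (hJ : ∀ v w, rOf (EuclideanSpace.basisFun (Fin 4) ℝ) J v w =
      rOf (EuclideanSpace.basisFun (Fin 4) ℝ) J w v)
    (hΓ : GammaTwoPos (fun a c ↦ gvForm G t y (pOf (EuclideanSpace.basisFun (Fin 4) ℝ) J)
      (rOf (EuclideanSpace.basisFun (Fin 4) ℝ) J) (b a) (b c)))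
    (hcM : c / 2 < sigma2 (fun a c ↦ gvForm G t y (pOf (EuclideanSpace.basisFun (Fin 4) ℝ) J)
      (rOf (EuclideanSpace.basisFun (Fin 4) ℝ) J) (b a) (b c)))
    {Ω : (Fin 2 → Fin 4) → ℝ} (hΩ : ∀ i j, Ω ![i, j] = Ω ![j, i]) :
    fderiv ℝ (fderiv ℝ (ekOperator G W Q ψ)) ((y : EuclideanSpace ℝ (Fin 4)), t, J)
        ((0 : EuclideanSpace ℝ (Fin 4)), (0 : ℝ), topJet Ω)
        ((0 : EuclideanSpace ℝ (Fin 4)), (0 : ℝ), topJet Ω) ≤ 0 := by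
  have hMs := fun a c ↦ gvForm_frame_symm g hG t y b (pOf (EuclideanSpace.basisFun (Fin 4) ℝ) J) hJ a c
  have hBs := topJet_frame_symm g hG t y b hΩ
  -- (i) `s ↦ D(ekOperator)(y,t,J + s·topJet Ω)[(0,0,topJet Ω)]` has derivative `D²[v,v]` at `0`
  have hopen : IsOpen {x : (EuclideanSpace ℝ (Fin 4)) × ℝ × CJet (Fin 4) 2 | x.1 ∈ (U : Set (EuclideanSpace ℝ (Fin 4)))} :=
    U.2.preimage continuous_fst
  have hΦ2 : ContDiffAt ℝ 2 (ekOperator G W Q ψ) ((y : (EuclideanSpace ℝ (Fin 4))), t, J + (0 : ℝ) • topJet Ω) := by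
    rw [zero_smul, add_zero]
    exact ((contDiffOn_ekOperator g hG hW hQ hψ).contDiffAt (hopen.mem_nhds y.2)).of_le
      (WithTop.coe_le_coe.mpr le_top)
  have hcurve : ∀ s : ℝ, HasDerivAt
      (fun s : ℝ ↦ (((y : (EuclideanSpace ℝ (Fin 4))), t, J + s • topJet Ω) : (EuclideanSpace ℝ (Fin 4)) × ℝ × CJet (Fin 4) 2))
      ((0 : (EuclideanSpace ℝ (Fin 4))), (0 : ℝ), topJet Ω) s := fun s ↦ by
    have h := ((hasDerivAt_id s).smul_const (topJet Ω : CJet (Fin 4) 2)).const_add J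
    simp only [id_eq, one_smul] at h
    exact (hasDerivAt_const s (y : (EuclideanSpace ℝ (Fin 4)))).prodMk ((hasDerivAt_const s t).prodMk h)
  have h1 := hasDerivAt_deriv_comp_curve (F := ekOperator G W Q ψ)
    (c := fun s : ℝ ↦ (((y : (EuclideanSpace ℝ (Fin 4))), t, J + s • topJet Ω) : (EuclideanSpace ℝ (Fin 4)) × ℝ × CJet (Fin 4) 2))
    (c' := fun _ ↦ ((0 : (EuclideanSpace ℝ (Fin 4))), (0 : ℝ), topJet Ω))
    (c'' := fun _ ↦ (0 : (EuclideanSpace ℝ (Fin 4)) × ℝ × CJet (Fin 4) 2)) hΦ2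
    (Filter.Eventually.of_forall hcurve) (hasDerivAt_const _ _)
  simp only [zero_smul, add_zero, map_zero] at h1
  -- (ii) near `s = 0` this function is the explicit `(σ₂(M,B) + sσ₂(B))/σ₂(M+sB)^{1/2}`
  have hfd := (eventually_lt_sigma2_line hMs hBs hcM).mono fun s hs ↦
    fderiv_ekOperator_topJet_line g hG t y hb hW hQ hψ hψc hJ hΩ hs
  have h2 := sqrt_sigma2_line_second_deriv_nonpos hMs hBs hΓ
  rw [h1.unique (h2.1.congr_of_eventuallyEq hfd)]
  exact h2.2

/-! ### Concavity in the top slot: the supporting hyperplane at a hybrid jet -/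

include hG in
/-- **The supporting-hyperplane inequality at a hybrid jet (Gilbarg–Trudinger's use of (ii)'
between `D²u(y)` and `D²u(x)`)**: for jets `J` (at `y`) and `J'` whose frame arrays `M`
(of `(pOf J, rOf J)`) and `M'` (of the hybrid `(pOf J, rOf J')`) are admissible with
`σ₂ > c/2`, resp. `≥ c/2`, `ekOperator(y,t,J + topJet(J'₂ − J₂)) − ekOperator(y,t,J) ≤
D(ekOperator)(y,t,J)[(0,0,topJet(J'₂ − J₂))]` (`sqrt_sigma2_le_tangent` and
`fderiv_ekOperator_topJet` with `Ω = J'₂ − J₂`, whose array `B` is `M' − M`).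
[cite: GilbargTrudinger2001, §17.4, proof of Thm. 17.14; GurskyViaclovsky2003, Prop. 1 (iii)] -/
theorem ekOperator_hybrid_sub_le (t : ℝ) (y : U)
    {b : Basis (Fin 4) ℝ (TangentSpace 𝓘(ℝ, EuclideanSpace ℝ (Fin 4)) y)}
    (hb : g.IsOrthonormalFrame y b) {W Q : EuclideanSpace ℝ (Fin 4) → ℝ}
    (hW : ContDiffOn ℝ ∞ W (U : Set (EuclideanSpace ℝ (Fin 4))))
    (hQ : ContDiffOn ℝ ∞ Q (U : Set (EuclideanSpace ℝ (Fin 4)))) {ψ : ℝ → ℝ} {c : ℝ}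
    (hψ : ContDiff ℝ ∞ ψ) (hψc : ∀ s, c / 2 ≤ s → ψ s = Real.sqrt s) {J J' : CJet (Fin 4) 2}
    (hJ : ∀ v w, rOf (EuclideanSpace.basisFun (Fin 4) ℝ) J v w =
      rOf (EuclideanSpace.basisFun (Fin 4) ℝ) J w v)
    (hJ' : ∀ v w, rOf (EuclideanSpace.basisFun (Fin 4) ℝ) J' v w =
      rOf (EuclideanSpace.basisFun (Fin 4) ℝ) J' w v)
    (hΓ : GammaTwoPos (fun a c ↦ gvForm G t y (pOf (EuclideanSpace.basisFun (Fin 4) ℝ) J)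
      (rOf (EuclideanSpace.basisFun (Fin 4) ℝ) J) (b a) (b c)))
    (hcM : c / 2 < sigma2 (fun a c ↦ gvForm G t y (pOf (EuclideanSpace.basisFun (Fin 4) ℝ) J)
      (rOf (EuclideanSpace.basisFun (Fin 4) ℝ) J) (b a) (b c)))
    (hΓ' : GammaTwoPos (fun a c ↦ gvForm G t y (pOf (EuclideanSpace.basisFun (Fin 4) ℝ) J)
      (rOf (EuclideanSpace.basisFun (Fin 4) ℝ) J') (b a) (b c)))
    (hcM' : c / 2 ≤ sigma2 (fun a c ↦ gvForm G t y (pOf (EuclideanSpace.basisFun (Fin 4) ℝ) J)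
      (rOf (EuclideanSpace.basisFun (Fin 4) ℝ) J') (b a) (b c))) :
    ekOperator G W Q ψ ((y : EuclideanSpace ℝ (Fin 4)), t,
        J + topJet (J' (Fin.last 2) - J (Fin.last 2))) -
      ekOperator G W Q ψ ((y : EuclideanSpace ℝ (Fin 4)), t, J) ≤
      fderiv ℝ (ekOperator G W Q ψ) ((y : EuclideanSpace ℝ (Fin 4)), t, J)
        ((0 : EuclideanSpace ℝ (Fin 4)), (0 : ℝ), topJet (J' (Fin.last 2) - J (Fin.last 2))) := by
  -- the hybrid jet `J + topJet Ω`, `Ω = J'₂ − J₂`: `pOf = pOf J`, `rOf = rOf J'`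
  have htop : (J + topJet (J' (Fin.last 2) - J (Fin.last 2))) 2 = J' 2 := by
    rw [Pi.add_apply, topJet_apply_two]
    show J 2 + (J' 2 - J 2) = J' 2
    abel
  have hr' : rOf (EuclideanSpace.basisFun (Fin 4) ℝ) (J + topJet (J' (Fin.last 2) - J (Fin.last 2))) = rOf (EuclideanSpace.basisFun (Fin 4) ℝ) J' :=
    rOf_congr_two (EuclideanSpace.basisFun (Fin 4) ℝ) htop
  have hp' : pOf (EuclideanSpace.basisFun (Fin 4) ℝ) (J + topJet (J' (Fin.last 2) - J (Fin.last 2))) = pOf (EuclideanSpace.basisFun (Fin 4) ℝ) J := by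
    rw [(isBoundedLinearMap_pOf (EuclideanSpace.basisFun (Fin 4) ℝ)).toIsLinearMap.map_add, pOf_topJet, add_zero]
  have hρ : rOf (EuclideanSpace.basisFun (Fin 4) ℝ) (topJet (J' (Fin.last 2) - J (Fin.last 2))) = rOf (EuclideanSpace.basisFun (Fin 4) ℝ) J' - rOf (EuclideanSpace.basisFun (Fin 4) ℝ) J := by
    rw [← (isBoundedLinearMap_rOf (EuclideanSpace.basisFun (Fin 4) ℝ)).toIsLinearMap.map_sub]
    exact rOf_congr_two (EuclideanSpace.basisFun (Fin 4) ℝ) (by rw [topJet_apply_two]; rfl)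
  have hΩ : ∀ i j, (J' (Fin.last 2) - J (Fin.last 2)) ![i, j] =
      (J' (Fin.last 2) - J (Fin.last 2)) ![j, i] := by
    intro i j
    show J' 2 ![i, j] - J 2 ![i, j] = J' 2 ![j, i] - J 2 ![j, i]
    rw [← rOf_apply_basis (EuclideanSpace.basisFun (Fin 4) ℝ) J' i j, ← rOf_apply_basis (EuclideanSpace.basisFun (Fin 4) ℝ) J' j i, ← rOf_apply_basis (EuclideanSpace.basisFun (Fin 4) ℝ) J i j,
      ← rOf_apply_basis (EuclideanSpace.basisFun (Fin 4) ℝ) J j i, hJ ((EuclideanSpace.basisFun (Fin 4) ℝ) i) ((EuclideanSpace.basisFun (Fin 4) ℝ) j), hJ' ((EuclideanSpace.basisFun (Fin 4) ℝ) i) ((EuclideanSpace.basisFun (Fin 4) ℝ) j)]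
  have harr : (fun a c ↦ gvForm G t y (pOf (EuclideanSpace.basisFun (Fin 4) ℝ) J) (rOf (EuclideanSpace.basisFun (Fin 4) ℝ) J') (b a) (b c)) = fun a c ↦
      gvForm G t y (pOf (EuclideanSpace.basisFun (Fin 4) ℝ) J) (rOf (EuclideanSpace.basisFun (Fin 4) ℝ) J) (b a) (b c) +
        (rOf (EuclideanSpace.basisFun (Fin 4) ℝ) (topJet (J' (Fin.last 2) - J (Fin.last 2))) (b a) (b c) +
          (1 - t) / 2 * mtrAt G y (rOf (EuclideanSpace.basisFun (Fin 4) ℝ) (topJet (J' (Fin.last 2) - J (Fin.last 2)))) *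
            G y (b a) (b c)) := by
    funext a c
    rw [← gvForm_add_right, hρ, add_sub_cancel]
  have e4 : ∀ x : ℝ, (4 * x - 0 / 4) / 4 = x := fun x ↦ by ring
  have hMs := fun a c ↦ gvForm_frame_symm g hG t y b (pOf (EuclideanSpace.basisFun (Fin 4) ℝ) J) hJ a c
  have hM's := fun a c ↦ gvForm_frame_symm g hG t y b (pOf (EuclideanSpace.basisFun (Fin 4) ℝ) J) hJ' a c
  have h := sqrt_sigma2_le_tangent hMs hM's hΓ hΓ'
  rw [ekOperator_apply, ekOperator_apply, hp', hr', add_topJet_apply_zero,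
    chartOperator_eq_sigma2_frame g hG t 0 y hb (pOf (EuclideanSpace.basisFun (Fin 4) ℝ) J) hJ',
    chartOperator_eq_sigma2_frame g hG t 0 y hb (pOf (EuclideanSpace.basisFun (Fin 4) ℝ) J) hJ, e4, e4, hψc _ hcM',
    hψc _ hcM.le, fderiv_ekOperator_topJet g hG t y hb hW hQ hψ hψc hJ hcM hΩ]
  rw [harr] at h ⊢
  rw [sigma2Polar_add_right, sigma2Polar_self hMs, add_sub_cancel_left] at h
  linarith

/-! ### At the jets of a solution -/

include hG in
/-- **Concavity at the jets of a solution** (the form consumed by the abstract Evans–Krylov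
theorem): along a smooth admissible solution of the background equation with `q ≥ q₀ > 0`,
`|f| ≤ C`, `t ≤ 1`, and a cutoff `ψ = √` on `[c/2, ∞)` with `0 < c ≤ q₀e^{−4C}/4`, the second
top-slot derivative of the Evans–Krylov jet function at `(y, t, cjet₂F(y))` is `≤ 0` in every
symmetric direction (`le_sigma2Inv_of_equation`, `sqrt_le_trace_of_equation`,
`gammaTwoPos_frame_of_pos`, `sigma2Inv_eq_sigma2_frame`, `rOf_cjetOf`, symmetry of `D²F(y)`).
[cite: GilbargTrudinger2001, §17.4, (17.45); GurskyViaclovsky2003, Prop. 6] -/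
theorem fderiv_fderiv_ekOperator_nonpos_of_solution (hg : g.IsRiemannian)
    {W Q : EuclideanSpace ℝ (Fin 4) → ℝ}
    (hW : ContDiffOn ℝ ∞ W (U : Set (EuclideanSpace ℝ (Fin 4))))
    (hQ : ContDiffOn ℝ ∞ Q (U : Set (EuclideanSpace ℝ (Fin 4)))) {ψ : ℝ → ℝ} {c : ℝ}
    (hψ : ContDiff ℝ ∞ ψ) (hψc : ∀ s, c / 2 ≤ s → ψ s = Real.sqrt s) (hc : 0 < c)
    {f : U → ℝ} (hf : ContMDiff 𝓘(ℝ, EuclideanSpace ℝ (Fin 4)) 𝓘(ℝ) ∞ f)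
    {F : EuclideanSpace ℝ (Fin 4) → ℝ} (hfF : ∀ y : U, f y = F y) {q : U → ℝ} {t q₀ C : ℝ}
    (ht : t ≤ 1) (hq₀ : 0 < q₀) (hcq : c ≤ q₀ * Real.exp (-4 * C) / 4) (y : U)
    (hF : ContDiffAt ℝ 2 F y) (hqy : q₀ ≤ q y)
    (heq : backgroundPathOperator g t (fun z ↦ -f z) y = q y * Real.exp (-4 * (-f y)))
    (hpos : 0 < backgroundScalar g (fun z ↦ -f z) y) (hfy : |f y| ≤ C)
    {Ω : (Fin 2 → Fin 4) → ℝ} (hΩ : ∀ i j, Ω ![i, j] = Ω ![j, i]) :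
    fderiv ℝ (fderiv ℝ (ekOperator G W Q ψ))
        ((y : EuclideanSpace ℝ (Fin 4)), t, cjetOf (EuclideanSpace.basisFun (Fin 4) ℝ) 2 F y)
        ((0 : EuclideanSpace ℝ (Fin 4)), (0 : ℝ), topJet Ω)
        ((0 : EuclideanSpace ℝ (Fin 4)), (0 : ℝ), topJet Ω) ≤ 0 := by
  obtain ⟨b, hb⟩ := g.exists_basis_isOrthonormalFrame (x := y) (fun v hv ↦ hg y v hv)
    finrank_euclideanSpace_fin
  obtain ⟨hr, hΓ, hcM⟩ := solution_frame_admissible g hG hg hc hf hfF ht hq₀ hcq y hF hqy heq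
    hpos hfy hb
  have hpJ : pOf (EuclideanSpace.basisFun (Fin 4) ℝ) (cjetOf (EuclideanSpace.basisFun (Fin 4) ℝ) 2 F y) = fderiv ℝ F y := pOf_cjetOf (EuclideanSpace.basisFun (Fin 4) ℝ)
  have hrJ : rOf (EuclideanSpace.basisFun (Fin 4) ℝ) (cjetOf (EuclideanSpace.basisFun (Fin 4) ℝ) 2 F y) = fderiv ℝ (fderiv ℝ F) y := rOf_cjetOf (EuclideanSpace.basisFun (Fin 4) ℝ) hF
  refine fderiv_fderiv_ekOperator_topJet_nonpos g hG t y hb hW hQ hψ hψc ?_ ?_ ?_ hΩ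
  · rw [hrJ]; exact hr
  · rw [hpJ, hrJ]; exact hΓ
  · rw [hpJ, hrJ]; exact hcM

include hG in
/-- **The coupling inequality at the hybrid jets of a solution** (the form consumed by the
abstract Evans–Krylov theorem): with the data of `fderiv_fderiv_ekOperator_nonpos_of_solution`
at `y`, a second point `x ∈ U` where `F` is `C²`, and the hybrid margins
`Σ^t(y, DF(y), D²F(x)) ≥ c/2`, `tr_G 𝒜^t(y, DF(y), D²F(x)) > 0` (supplied uniformly for
`|x − y| ≤ δ₀` by the Margin/HybridMargin files),
`ekOperator(y,t,J_y + topJet(J_x,₂ − J_y,₂)) − ekOperator(y,t,J_y) ≤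
D(ekOperator)(y,t,J_y)[(0,0,topJet(J_x,₂ − J_y,₂))]`, `J_z = cjet₂F(z)`.
[cite: GilbargTrudinger2001, §17.4, proof of Thm. 17.14] -/
theorem ekOperator_hybrid_sub_le_of_solution (hg : g.IsRiemannian)
    {W Q : EuclideanSpace ℝ (Fin 4) → ℝ}
    (hW : ContDiffOn ℝ ∞ W (U : Set (EuclideanSpace ℝ (Fin 4))))
    (hQ : ContDiffOn ℝ ∞ Q (U : Set (EuclideanSpace ℝ (Fin 4)))) {ψ : ℝ → ℝ} {c : ℝ}
    (hψ : ContDiff ℝ ∞ ψ) (hψc : ∀ s, c / 2 ≤ s → ψ s = Real.sqrt s) (hc : 0 < c)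
    {f : U → ℝ} (hf : ContMDiff 𝓘(ℝ, EuclideanSpace ℝ (Fin 4)) 𝓘(ℝ) ∞ f)
    {F : EuclideanSpace ℝ (Fin 4) → ℝ} (hfF : ∀ y : U, f y = F y) {q : U → ℝ} {t q₀ C : ℝ}
    (ht : t ≤ 1) (hq₀ : 0 < q₀) (hcq : c ≤ q₀ * Real.exp (-4 * C) / 4) (y : U)
    (hF : ContDiffAt ℝ 2 F y) (hqy : q₀ ≤ q y)
    (heq : backgroundPathOperator g t (fun z ↦ -f z) y = q y * Real.exp (-4 * (-f y)))
    (hpos : 0 < backgroundScalar g (fun z ↦ -f z) y) (hfy : |f y| ≤ C)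
    (x : U) (hFx : ContDiffAt ℝ 2 F x)
    (hhybS : c / 2 ≤
      1 / 2 * (mtrAt G y (gvForm G t y (fderiv ℝ F y) (fderiv ℝ (fderiv ℝ F) x)) ^ 2 -
        normSqAt G y (gvForm G t y (fderiv ℝ F y) (fderiv ℝ (fderiv ℝ F) x))))
    (hhybT : 0 < mtrAt G y (gvForm G t y (fderiv ℝ F y) (fderiv ℝ (fderiv ℝ F) x))) :
    ekOperator G W Q ψ ((y : EuclideanSpace ℝ (Fin 4)), t,
        cjetOf (EuclideanSpace.basisFun (Fin 4) ℝ) 2 F y +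
          topJet (cjetOf (EuclideanSpace.basisFun (Fin 4) ℝ) 2 F x (Fin.last 2) -
            cjetOf (EuclideanSpace.basisFun (Fin 4) ℝ) 2 F y (Fin.last 2))) -
      ekOperator G W Q ψ ((y : EuclideanSpace ℝ (Fin 4)), t,
        cjetOf (EuclideanSpace.basisFun (Fin 4) ℝ) 2 F y) ≤
      fderiv ℝ (ekOperator G W Q ψ)
        ((y : EuclideanSpace ℝ (Fin 4)), t, cjetOf (EuclideanSpace.basisFun (Fin 4) ℝ) 2 F y)
        ((0 : EuclideanSpace ℝ (Fin 4)), (0 : ℝ),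
          topJet (cjetOf (EuclideanSpace.basisFun (Fin 4) ℝ) 2 F x (Fin.last 2) -
            cjetOf (EuclideanSpace.basisFun (Fin 4) ℝ) 2 F y (Fin.last 2))) := by
  obtain ⟨b, hb⟩ := g.exists_basis_isOrthonormalFrame (x := y) (fun v hv ↦ hg y v hv)
    finrank_euclideanSpace_fin
  obtain ⟨hr, hΓ, hcM⟩ := solution_frame_admissible g hG hg hc hf hfF ht hq₀ hcq y hF hqy heq
    hpos hfy hb
  have hrx : ∀ v w, fderiv ℝ (fderiv ℝ F) x v w = fderiv ℝ (fderiv ℝ F) x w v := fun v w ↦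
    (hFx.isSymmSndFDerivAt (by simp)).eq v w
  obtain ⟨hΓ', hσ'⟩ := gammaTwoPos_frame_of_pos g hG t y hb (fderiv ℝ F y) hrx
    (by linarith) hhybT
  have hpJ : pOf (EuclideanSpace.basisFun (Fin 4) ℝ) (cjetOf (EuclideanSpace.basisFun (Fin 4) ℝ) 2 F y) = fderiv ℝ F y := pOf_cjetOf (EuclideanSpace.basisFun (Fin 4) ℝ)
  have hrJ : rOf (EuclideanSpace.basisFun (Fin 4) ℝ) (cjetOf (EuclideanSpace.basisFun (Fin 4) ℝ) 2 F y) = fderiv ℝ (fderiv ℝ F) y := rOf_cjetOf (EuclideanSpace.basisFun (Fin 4) ℝ) hF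
  have hrJ' : rOf (EuclideanSpace.basisFun (Fin 4) ℝ) (cjetOf (EuclideanSpace.basisFun (Fin 4) ℝ) 2 F x) = fderiv ℝ (fderiv ℝ F) x := rOf_cjetOf (EuclideanSpace.basisFun (Fin 4) ℝ) hFx
  refine ekOperator_hybrid_sub_le g hG t y hb hW hQ hψ hψc ?_ ?_ ?_ ?_ ?_ ?_
  · rw [hrJ]; exact hr
  · rw [hrJ']; exact hrx
  · rw [hpJ, hrJ]; exact hΓ
  · rw [hpJ, hrJ]; exact hcM
  · rw [hpJ, hrJ']; exact hΓ'
  · rw [hpJ, hrJ', hσ']; exact hhybS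

end OpensChart

end Literature.Geometry.Riemannian.GurskyViaclovskyPath

end
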